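import Mathlib
import Literature.NumberTheory.EllipticCurves.Smith2016.CongruentNumberGenusDeterminantRowSevenForest

/-!
# Smith 2016, Theorem 2.2 row 7(a) in forest form (every `k`): `det M_{7a}` via mark- and root-copy second minors

A. Smith, *The congruent numbers have positive natural density*, arXiv:1603.08479 [Smith2016CongruentDensity],
Table 2 row 7(a) (source `cnc.tex` l. 109–116): `ℒ_{7a}(n) = Σ_{d | n, d ≡ 7 (8)} g(d)ℒ(n/d)`,
`M_{7a} = [[A + Aᵀ, Aᵀ, y + z, 0],[A, D_z, 0, y],[(y+z)ᵀ, 0, 0, 0],[0, yᵀ, 0, 0]]`; §2.2 (source `cnc2.tex` l. 44–52),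
(eq:7a_develop): `det M_{7a} = Σ_S det O(A, y, y+z)[S] det M₁[S′] + Σ_{S₀ ⊆ S} det O(A, z, y+z)[S₀] det N(A, z, y)[S − S₀] det M₁[S′]`
and "the second sum … is zero if `n` equals `7` mod `8`, as `5 · 5 · 1 ≢ 7 (mod 8)`".
Here `y = t = ((−1/pᵢ)₊)`, `z = ((2/pᵢ)₊)`; `M_{7a}` is the iterated bordered block matrix
`[[[[M₁, (t+z;0)],[(t+z;0)ᵀ, 0]], ((0;t);0)],[((0;t);0)ᵀ, 0]]`.

* `det_sevenA_eq_sum_sum` — transport by `E = [[I,I],[0,I]]` (`(0;t) ↦ (t;t)`) and the double-border expansion: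
  `det M_{7a} = Σ_j Σ_{i≠j} t_j (t+z)_i det N₁^{(inl i, inl j)} + Σ_j Σ_i t_j (t+z)_i det N₁^{(inl i, inr j)}`;
* `det_sevenA_eq_sum_powerset` — by `BipartiteForestSecondCofactor`: the 7(b)-type double sum
  `Σ_B t_B q_z(A^B) Σ_{B′} (t+z)_{B′} q_z(A^{B′}) e₁` plus `Σ_B (t+z)_B q_t(A^B) e₁([k]∖B) + Σ_B z_B q_t(A^B) Σ_{B′} (t+z)_{B′} q_z(A^{B′}) e₁`
  — Smith's two sums of (eq:7a_develop), with `det O(A, t, t+z)[B] = (t+z)_B q_t(A^B)` and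
  `det N(A, z, t)[B] = t_B q_z(A^B) + z_B q_t(A^B)`;
* `det_sevenA_eq_sum_genusWeight` — **for `∏ pᵢ ≡ 7 (mod 8)`: `det M_{7a} = Σ_{B ⊆ [k], d_B ≡ 7 (8)} g(d_B) · ℒ(d_{[k]∖B})`**,
  Smith's `ℒ_{7a}(n)` over index blocks (the `N`-terms vanish: a `(3, 5, 1)`- or `(5, 5, 1)`-configuration cannot
  multiply to `7 (mod 8)`).
The identification with `Σ₁(n)` and the `2`-Selmer consequence are in `CongruentNumberGenusDeterminantRowSevenA`.
-/

namespace Literature.NumberTheory.EllipticCurves.Smith2016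

open _root_.Matrix Finset Literature.LinearAlgebra.Matrix Literature.Combinatorics.Enumerative
open Literature.NumberTheory.EllipticCurves.HeathBrown1994
open Literature.NumberTheory.EllipticCurves.TianYuanZhang2017
open Literature.NumberTheory.EllipticCurves.HeathBrown1994.Families (legendreMatrix_apply_of_ne legendreMatrix_apply_self)
open Literature.NumberTheory.EllipticCurves.MonskySelmerParity

variable {k : ℕ} (p : Fin k → ℕ)

section SevenAForest

/-- **`det M_{7a}` as double sums of second-order minors of `N₁`** (every `k`): with `t = ((−1/pᵢ)₊)`, `z = ((2/pᵢ)₊)`,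
`N₁ = bigN a univ z z z`:
`det M_{7a} = Σ_j Σ_{i ≠ j} t_j (t+z)_i det(N₁; inl i, inl j unitized) + Σ_j Σ_i t_j (t+z)_i det(N₁; inl i, inr j unitized)`
(the border `(0; t)` becomes `(t; t)` under `E`). [cite: Smith2016CongruentDensity, Thm. 2.2 row 7(a) / Table 2 (source cnc.tex l. 109–116) and §2.2 (cnc2.tex l. 44–52, (eq:7a_develop))] -/
theorem det_sevenA_eq_sum_sum :
    (fromBlocks (fromBlocks (fromBlocks (legendreMatrix p + (legendreMatrix p)ᵀ) (legendreMatrix p)ᵀ (legendreMatrix p)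
          (legendreDiagonal p 2))
        (replicateCol Unit (Sum.elim (fun i => addLegendreSym (-1) (p i) + addLegendreSym 2 (p i)) (0 : Fin k → ZMod 2)))
        (replicateRow Unit (Sum.elim (fun i => addLegendreSym (-1) (p i) + addLegendreSym 2 (p i)) (0 : Fin k → ZMod 2))) 0)
      (replicateCol Unit (Sum.elim (Sum.elim (0 : Fin k → ZMod 2) (fun i => addLegendreSym (-1) (p i))) 0))
      (replicateRow Unit (Sum.elim (Sum.elim (0 : Fin k → ZMod 2) (fun i => addLegendreSym (-1) (p i))) 0)) 0).det =
      ∑ j, ∑ i ∈ univ.erase j, addLegendreSym (-1) (p j) * (addLegendreSym (-1) (p i) + addLegendreSym 2 (p i)) *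
        (unitize (unitize (bigN (fun i j => legendreMatrix p i j) univ (fun i => addLegendreSym 2 (p i))
          (fun i => addLegendreSym 2 (p i)) (fun i => addLegendreSym 2 (p i))) (Sum.inl i)) (Sum.inl j)).det +
      ∑ j, ∑ i, addLegendreSym (-1) (p j) * (addLegendreSym (-1) (p i) + addLegendreSym 2 (p i)) *
        (unitize (unitize (bigN (fun i j => legendreMatrix p i j) univ (fun i => addLegendreSym 2 (p i))
          (fun i => addLegendreSym 2 (p i)) (fun i => addLegendreSym 2 (p i))) (Sum.inl i)) (Sum.inr j)).det := by
  have hD2 : legendreDiagonal p 2 = diagonal fun i => addLegendreSym 2 (p i) := rfl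
  have hNeq : fromBlocks (legendreDiagonal p 2) ((legendreMatrix p)ᵀ + legendreDiagonal p 2)
      (legendreMatrix p + legendreDiagonal p 2) (legendreDiagonal p 2) =
      bigN (fun i j => legendreMatrix p i j) univ (fun i => addLegendreSym 2 (p i))
        (fun i => addLegendreSym 2 (p i)) (fun i => addLegendreSym 2 (p i)) := by
    rw [bigN_univ_eq_fromBlocks _ (legendreMatrix_apply_self p), hD2, transpose_add, diagonal_transpose]
  rw [det_border_border_transport, fromBlocks_one_one_zero_one_mulVec_elim, fromBlocks_one_one_zero_one_mulVec_elim,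
    add_zero, zero_add, hNeq, det_fromBlocks_border_border (bigN_transpose _ _ _ _ _), Fintype.sum_sum_type]
  simp only [Sum.elim_inl, Sum.elim_inr]
  congr 1
  · refine sum_congr rfl fun j _ => ?_
    rw [mul_sum, Fintype.sum_sum_type]
    simp only [Sum.elim_inl, Sum.elim_inr, Pi.zero_apply, ite_self, zero_mul, mul_zero, sum_const_zero, add_zero]
    rw [← add_sum_erase _ _ (mem_univ j), if_pos rfl, zero_mul, mul_zero, zero_add]
    refine sum_congr rfl fun i hi => ?_
    rw [if_neg (fun h => (ne_of_mem_erase hi) (Sum.inl_injective h)), unitize_comm]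
    ring
  · refine sum_congr rfl fun j _ => ?_
    rw [mul_sum, Fintype.sum_sum_type]
    simp only [Sum.elim_inl, Sum.elim_inr, Pi.zero_apply, ite_self, zero_mul, mul_zero, sum_const_zero, add_zero]
    refine sum_congr rfl fun i _ => ?_
    rw [if_neg Sum.inl_ne_inr, unitize_comm]
    ring

/-- **`det M_{7a}` as pointed forest sums** (every `k`): Smith's (eq:7a_develop) with all blocks in forest form —
the 7(b)-type double sum plus `Σ_B (t+z)_B q_t(A^B) e₁([k]∖B)` (`det O(A, t, t+z)[S]·det M₁[S′]`) plus
`Σ_B z_B q_t(A^B) Σ_{B′} (t+z)_{B′} q_z(A^{B′}) e₁` (together with the first sum: `det O(A,z,t+z)[S₀]·det N(A,z,t)[S−S₀]·det M₁[S′]`).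
[cite: Smith2016CongruentDensity, §2.2 (source cnc2.tex l. 44–52, (eq:7a_develop))] [cite: Chaiken1982, §2] -/
theorem det_sevenA_eq_sum_powerset :
    (fromBlocks (fromBlocks (fromBlocks (legendreMatrix p + (legendreMatrix p)ᵀ) (legendreMatrix p)ᵀ (legendreMatrix p)
          (legendreDiagonal p 2))
        (replicateCol Unit (Sum.elim (fun i => addLegendreSym (-1) (p i) + addLegendreSym 2 (p i)) (0 : Fin k → ZMod 2)))
        (replicateRow Unit (Sum.elim (fun i => addLegendreSym (-1) (p i) + addLegendreSym 2 (p i)) (0 : Fin k → ZMod 2))) 0)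
      (replicateCol Unit (Sum.elim (Sum.elim (0 : Fin k → ZMod 2) (fun i => addLegendreSym (-1) (p i))) 0))
      (replicateRow Unit (Sum.elim (Sum.elim (0 : Fin k → ZMod 2) (fun i => addLegendreSym (-1) (p i))) 0)) 0).det =
      ∑ B ∈ (univ : Finset (Fin k)).powerset, (∑ m ∈ B, addLegendreSym (-1) (p m)) *
        qwt (fun i j => legendreMatrix p i j) (fun i => addLegendreSym 2 (p i)) B *
        ∑ B' ∈ (univ \ B).powerset, (∑ m ∈ B', (addLegendreSym (-1) (p m) + addLegendreSym 2 (p m))) *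
          qwt (fun i j => legendreMatrix p i j) (fun i => addLegendreSym 2 (p i)) B' *
          setExp (fwt (fun i j => legendreMatrix p i j) (fun i => addLegendreSym 2 (p i))
            (fun i => addLegendreSym 2 (p i)) (fun i => addLegendreSym 2 (p i))) ((univ \ B) \ B') +
      (∑ B ∈ (univ : Finset (Fin k)).powerset, (∑ m ∈ B, (addLegendreSym (-1) (p m) + addLegendreSym 2 (p m))) *
          qwt (fun i j => legendreMatrix p i j) (fun i => addLegendreSym (-1) (p i)) B *
          setExp (fwt (fun i j => legendreMatrix p i j) (fun i => addLegendreSym 2 (p i))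
            (fun i => addLegendreSym 2 (p i)) (fun i => addLegendreSym 2 (p i))) (univ \ B) +
        ∑ B ∈ (univ : Finset (Fin k)).powerset, (∑ m ∈ B, addLegendreSym 2 (p m)) *
          qwt (fun i j => legendreMatrix p i j) (fun i => addLegendreSym (-1) (p i)) B *
          ∑ B' ∈ (univ \ B).powerset, (∑ m ∈ B', (addLegendreSym (-1) (p m) + addLegendreSym 2 (p m))) *
            qwt (fun i j => legendreMatrix p i j) (fun i => addLegendreSym 2 (p i)) B' *
            setExp (fwt (fun i j => legendreMatrix p i j) (fun i => addLegendreSym 2 (p i))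
              (fun i => addLegendreSym 2 (p i)) (fun i => addLegendreSym 2 (p i))) ((univ \ B) \ B')) := by
  rw [det_sevenA_eq_sum_sum,
    ← sum_sum_mul_det_unitize_unitize_inl_inl _ univ _ _ _
      (fun i => addLegendreSym (-1) (p i) + addLegendreSym 2 (p i)) (fun j => addLegendreSym (-1) (p j)),
    ← sum_sum_mul_det_unitize_unitize_inl_inr _ univ _ _ _
      (fun i => addLegendreSym (-1) (p i) + addLegendreSym 2 (p i)) (fun j => addLegendreSym (-1) (p j))]

end SevenAForest

section SevenAGenus

/-- **`det M_{7a}` in genus class numbers** (Smith 2016, Thm. 2.2 row 7(a), every `k`): for `n = p₁⋯p_k ≡ 7 (mod 8)`,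
`det M_{7a} = Σ_{B ⊆ [k], d_B ≡ 7 (8)} g(d_B) · ℒ(d_{[k]∖B})` — Smith's `ℒ_{7a}(n) = Σ_{d | n, d ≡ 7 (8)} g(d)ℒ(n/d)` over
index blocks (`ℒ(m) = Σ_{D ∈ decompositions m} ∏ [d ≡ 1 (8)] g(d)`).  The `N`-terms of (eq:7a_develop) vanish: with
`ℒ(rest) ≠ 0` the residues would be `(3 or 5, 5, 1)`, which do not multiply to `7 (mod 8)`.
[cite: Smith2016CongruentDensity, Thm. 2.2 row 7(a) / Table 2 (source cnc.tex l. 109–116) and §2.2 (cnc2.tex l. 44–52: "5 · 5 · 1 ≢ 7 mod (8)")] -/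
theorem det_sevenA_eq_sum_genusWeight (hp : ∀ i, (p i).Prime) (hodd : ∀ i, Odd (p i))
    (hinj : Function.Injective p) (h8 : (∏ i, p i) % 8 = 7) :
    (fromBlocks (fromBlocks (fromBlocks (legendreMatrix p + (legendreMatrix p)ᵀ) (legendreMatrix p)ᵀ (legendreMatrix p)
          (legendreDiagonal p 2))
        (replicateCol Unit (Sum.elim (fun i => addLegendreSym (-1) (p i) + addLegendreSym 2 (p i)) (0 : Fin k → ZMod 2)))
        (replicateRow Unit (Sum.elim (fun i => addLegendreSym (-1) (p i) + addLegendreSym 2 (p i)) (0 : Fin k → ZMod 2))) 0)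
      (replicateCol Unit (Sum.elim (Sum.elim (0 : Fin k → ZMod 2) (fun i => addLegendreSym (-1) (p i))) 0))
      (replicateRow Unit (Sum.elim (Sum.elim (0 : Fin k → ZMod 2) (fun i => addLegendreSym (-1) (p i))) 0)) 0).det =
      ∑ B ∈ (univ : Finset (Fin k)).powerset,
        (if (∏ i ∈ B, p i) % 8 = 7 then ((genusClassNumber (GenusField (∏ i ∈ B, p i)) : ℕ) : ZMod 2) else 0) *
        ∑ D ∈ decompositions (∏ i ∈ univ \ B, p i), ∏ d ∈ D,
          (if d % 8 = 1 then ((genusClassNumber (GenusField d) : ℕ) : ZMod 2) else 0) := by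
  rw [det_sevenA_eq_sum_powerset, add_comm, add_assoc, ← sum_add_distrib]
  -- the `N`-terms: `Σ_B (t_B q_z + z_B q_t)(A^B) · Σ_{B′} (t+z)_{B′} q_z(A^{B′}) · e₁` vanishes for `n ≡ 7 (8)`
  have hN : ∑ B ∈ (univ : Finset (Fin k)).powerset,
      ((∑ m ∈ B, addLegendreSym 2 (p m)) * qwt (fun i j => legendreMatrix p i j) (fun i => addLegendreSym (-1) (p i)) B *
          ∑ B' ∈ (univ \ B).powerset, (∑ m ∈ B', (addLegendreSym (-1) (p m) + addLegendreSym 2 (p m))) *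
            qwt (fun i j => legendreMatrix p i j) (fun i => addLegendreSym 2 (p i)) B' *
            setExp (fwt (fun i j => legendreMatrix p i j) (fun i => addLegendreSym 2 (p i))
              (fun i => addLegendreSym 2 (p i)) (fun i => addLegendreSym 2 (p i))) ((univ \ B) \ B') +
        (∑ m ∈ B, addLegendreSym (-1) (p m)) * qwt (fun i j => legendreMatrix p i j) (fun i => addLegendreSym 2 (p i)) B *
          ∑ B' ∈ (univ \ B).powerset, (∑ m ∈ B', (addLegendreSym (-1) (p m) + addLegendreSym 2 (p m))) *
            qwt (fun i j => legendreMatrix p i j) (fun i => addLegendreSym 2 (p i)) B' *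
            setExp (fwt (fun i j => legendreMatrix p i j) (fun i => addLegendreSym 2 (p i))
              (fun i => addLegendreSym 2 (p i)) (fun i => addLegendreSym 2 (p i))) ((univ \ B) \ B')) = 0 := by
    refine sum_eq_zero fun B _ => ?_
    rw [← add_mul, add_comm, bracket_eq_sum_genusWeight p hp hodd hinj B, sum_mul]
    refine sum_eq_zero fun S hS => ?_
    rw [mem_powerset] at hS
    rw [mul_sum]
    refine sum_eq_zero fun B' hB' => ?_
    rw [mem_powerset] at hB'
    rw [pointedWeight_five_legendre_eq_genusWeight' p hp hodd hinj B',
      setExp_fwt_legendre_eq_sum_decompositions p hp hodd hinj ((univ \ B) \ B')]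
    -- the four block products
    have hSB : (∏ i ∈ B \ S, p i) * (∏ i ∈ S, p i) = ∏ i ∈ B, p i := prod_sdiff hS
    have hB'R : (∏ i ∈ (univ \ B) \ B', p i) * (∏ i ∈ B', p i) = ∏ i ∈ univ \ B, p i := prod_sdiff hB'
    have hBU : (∏ i ∈ univ \ B, p i) * (∏ i ∈ B, p i) = ∏ i, p i := prod_sdiff (subset_univ B)
    rcases em ((∏ i ∈ (univ \ B) \ B', p i) % 8 = 1) with hR | hR
    · rcases em ((∏ i ∈ B', p i) % 8 = 5) with h5 | h5
      · rcases em ((∏ i ∈ S, p i) % 8 = 3) with h3 | h3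
        · have hx : (∏ i ∈ B \ S, p i) % 4 = 1 := by
            have h1 := congrArg (· % 8) hSB
            have h2 := congrArg (· % 8) hB'R
            have h3' := congrArg (· % 8) hBU
            rw [Nat.mul_mod, h3] at h1
            rw [Nat.mul_mod, hR, h5] at h2
            rw [Nat.mul_mod, ← h2, ← h1, h8] at h3'
            omega
          rw [if_pos hx, mul_zero, zero_mul]
        · rw [if_neg h3, zero_mul, zero_mul]
      · rw [if_neg h5, zero_mul, mul_zero]
    · rw [sum_decompositions_rowOne_eq_zero p hR, mul_zero, mul_zero]
  rw [hN, add_zero]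
  -- the `O(A, t, t+z)`-terms: `(t+z)_B q_t(A^B) e₁([k]∖B) = [d_B ≡ 7 (8)] g(d_B) ℒ(d_{[k]∖B})`
  refine sum_congr rfl fun B _ => ?_
  rw [setExp_fwt_legendre_eq_sum_decompositions p hp hodd hinj (univ \ B)]
  have hBU : (∏ i ∈ univ \ B, p i) * (∏ i ∈ B, p i) = ∏ i, p i := prod_sdiff (subset_univ B)
  rcases em ((∏ i ∈ univ \ B, p i) % 8 = 1) with hR | hR
  · have h7 : (∏ i ∈ B, p i) % 8 = 7 := by
      have h := congrArg (· % 8) hBU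
      rw [Nat.mul_mod, hR, one_mul, Nat.mod_mod] at h
      omega
    have ht : ∑ m ∈ B, addLegendreSym (-1) (p m) = 1 := by
      rw [sum_addLegendreSym_neg_one_block_eq p hp hodd B, if_neg (by omega)]
    have hz : ∑ m ∈ B, addLegendreSym 2 (p m) = 0 := by
      rw [sum_addLegendreSym_two_block_eq p hodd B, if_neg (by omega)]
    have hq := pointedWeight_neg_one_legendre_eq_genusWeight' p hp hodd hinj B
    rw [ht, one_mul, if_neg (by omega)] at hq
    rw [sum_add_distrib, ht, hz, add_zero, one_mul, hq, if_pos h7]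
  · rw [sum_decompositions_rowOne_eq_zero p hR, mul_zero, mul_zero]

end SevenAGenus

end Literature.NumberTheory.EllipticCurves.Smith2016
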